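import Mathlib
import Literature.Analysis.ODE.VariationalEnclosureIntervalTest
import Summits.NavierStokesRegularity.NavierStokesRegularity.Theorems.TaoLadderRungTwoBreakOneShiftWindowTermFieldVarJets
import Summits.NavierStokesRegularity.NavierStokesRegularity.Theorems.TaoLadderRungTwoBreakOneShiftWindowStepSlope
import HarnessLib

/-!
# The one-shift window system, XXV: THE CENTRE SLOPE FROM BOX DATA — the C¹ high-order enclosure test of
# `Literature.Analysis.ODE.VariationalEnclosureIntervalTest` for the term-list centre field, composed with the
# row-wise mean value theorem of part XIV: the hypothesis `hM`/`hwc` of `exists_stepSlope` (and `hΦ`/`hΦenc` of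
# `exists_stepPairSlope`) from interval jets only (cell harvest/h2-tao-ladder, seat p2; rung1/KERNEL-CHEAP-REPLAY-SPEC.md
# §7 (R2); support for K1(1) = `NoSurvivingDSSOne`, stmt-NavierStokesRegularity-20205)

MODEL lattice ODEs only (Tao 2016 §4 normal form on Tao's shift set `S`); nothing here is a statement about
the Navier–Stokes equations; no item is closed; nothing numerical is proved. Generic in `ι`, `κ`.

The centre field of a step is `termField T` with constant external factors (the tails frozen at the tube
centres), smooth on `Ω = ⊤` (part XXI); its flow Taylor coefficient maps are `tjet T j = smoothTaylorMap` with
derivatives `smoothTaylorFDeriv` (parts XXIII/XXIV give their Cauchy-product recursions, which interval jets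
evaluate). The Literature theorem `hasFDerivWithinAt_flow_intervalTest_smoothOn_local` turns BOX DATA — `E_j ⊇ Φ_j(W)`
(`j < K`), `V ⊇ Φ_K(S)`, the state test `hoeBox T E V K ≤ S`, `EV_j ∋ DΦ_j` on `W`, `AK ∋ DΦ_K` on `S`,
`NN ⊇ AK·VV`, the `C¹` test `hoeMatBox T EV NN K ≤ VV` — into the derivative of the flow within `boxSet W` with
entries in `VV`, for ANY solution family from `W` staying in `S`. Part XIV then gives the slope matrix.

* `exists_centreSlope_of_boxData` — **for the centre family `u` (solutions of `x' = termField T x` on `[0, h]` from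
  the points of the box `W`, staying in the box `S`) and any `a, b ∈ boxSet W`, `τ ∈ [0, h]`: there is a real matrix
  `M` with `M i l ∈ VV i l` and `u a τ − u b τ = M · (a − b)`** — so `[CV, DV] := VV` in `exists_stepSlope` /
  `exists_stepPairSlope`. The remaining hypotheses are interval-arithmetic facts about jets (the replay's data).
-/

noncomputable section

-- the sub-problem namespace repeats the summit name by design (D-0017)
set_option linter.dupNamespace false

namespace Summit.NavierStokesRegularity.NavierStokesRegularity.Theorems

namespace DSSOneShift

open Set Metric Literature.Analysis.ODE TopologicalSpace NonemptyInterval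
open scoped ContDiff

variable {ι : Type*} [Fintype ι] [DecidableEq ι] {κ : Type*} [Fintype κ]

/-- **THE CENTRE SLOPE FROM BOX DATA.** See the module docstring. [cite: WalawskaWilczak2016, §2.1 and §2.2 Lemma 2; cell vocabulary, harvest/h2-tao-ladder rung1/KERNEL-CHEAP-REPLAY-SPEC.md §2 (c)/(e), §7 (R2)] -/
theorem exists_centreSlope_of_boxData (T : κ → BTerm ι) {K : ℕ} (hK : 0 < K) {h : ℝ} (hh : 0 ≤ h)
    {Tint : NonemptyInterval ℝ} (hT : ∀ t ∈ Icc 0 h, t ∈ Tint)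
    (W S V : ι → NonemptyInterval ℝ) (E : ℕ → ι → NonemptyInterval ℝ)
    (EV : ℕ → ι → ι → NonemptyInterval ℝ) (AK VV NN : ι → ι → NonemptyInterval ℝ)
    (hSu : UniqueDiffOn ℝ (boxSet S))
    (hE : ∀ j < K, MapsTo (tjet T j) (boxSet W) (boxSet (E j)))
    (hV : MapsTo (tjet T K) (boxSet S) (boxSet V)) (htest : hoeBox Tint E V K ≤ S)
    (hEV : ∀ j < K, ∀ x ∈ boxSet W, ∀ i l, vjet T j x (Pi.single l 1) i ∈ EV j i l)
    (hAK : ∀ z ∈ boxSet S, ∀ i l, vjet T K z (Pi.single l 1) i ∈ AK i l)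
    (hNN : imatmul AK VV ≤ NN) (htestV : hoeMatBox Tint EV NN K ≤ VV)
    {u : (ι → ℝ) → ℝ → ι → ℝ} (hu : IsSolutionFamily (termField T) (boxSet S) (boxSet W) h u)
    {a b : ι → ℝ} (ha : a ∈ boxSet W) (hb : b ∈ boxSet W) {τ : ℝ} (hτ : τ ∈ Icc 0 h) :
    ∃ M : Matrix ι ι ℝ, (∀ i l, M i l ∈ VV i l) ∧ u a τ - u b τ = M.mulVec (a - b) := by
  classical
  have hf := termField_contDiffOn T
  have hSΩ : boxSet S ⊆ ((⊤ : Opens (ι → ℝ)) : Set (ι → ℝ)) := fun _ _ => trivial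
  have hτT : τ ∈ Tint := hT τ hτ
  -- the flow derivative at every point of the box, with entries in `VV`
  have hJ : ∀ x ∈ boxSet W, ∃ J : (ι → ℝ) →L[ℝ] (ι → ℝ),
      HasFDerivWithinAt (fun x' => u x' τ) J (boxSet W) x ∧ ∀ i l, J (Pi.single l 1) i ∈ VV i l := by
    intro x hx
    obtain ⟨J, hJ, hJV, -, -⟩ := hasFDerivWithinAt_flow_intervalTest_smoothOn_local hf hK hh hT W S V E EV
      AK VV NN hSΩ hSu hE hV htest hEV hAK hNN htestV hu hx hτ hτT
    exact ⟨J, hJ, hJV⟩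
  choose! J hJd hJV using hJ
  -- part XIV: the slope matrix
  obtain ⟨M, hM, hrep⟩ := exists_slopeMatrix_of_fderiv (convex_boxSet W) (Φ := fun x' => u x' τ) (Φ' := J)
    (CV := fun i l => (VV i l).fst) (DV := fun i l => (VV i l).snd) (fun x hx => hJd x hx)
    (fun x hx i l => (NonemptyInterval.mem_def.1 (hJV x hx i l))) ha hb
  exact ⟨M, fun i l => NonemptyInterval.mem_def.2 (hM i l), hrep⟩

end DSSOneShift

end Summit.NavierStokesRegularity.NavierStokesRegularity.Theorems
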